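import Summits.ABC.ABC.Theses.YuMatveevShapeRat
import Summits.ABC.StewartYu.PadicG3SatNRecord
import Summits.ABC.StewartYu.PadicG3SatFrameD
import Summits.ABC.StewartYu.PadicG3ParNBudgetF
import Literature.NumberTheory.Transcendental.Nesterenko2003Prop51Holds
import HarnessLib

set_option linter.dupNamespace false

/-!
# Crux `PadicCoreOddRat` (stmt-ABC-20503) of route `YuMatveevShapeRat` — line `sat-odd` made sorry-free
# (cell abc-stewartyu, A1.L tranche; lead p2)

The KUMMER-FREE `p`-adic core over `ℚ` at an odd prime `p`, shape form `cⁿ·(p/log p)·∏A·(W + log p + log 2Amax)`, uniform in `p`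
(the text of `Summit.ABC.StewartYu.GenThreeInductionOdd.CoreOdd` with the signed 2-Kummer clause deleted), in the kernel.
Chain (all files under `Summits/ABC/StewartYu/`): the 𝔑-threaded (saturated) odd-`p` Gen-3 frame of memo-07 Θ′ («θ-algebra, α-sizes,
ξ-END») — `SatCoords`/`PadicG3SatData` (Cassels-reduced saturated basis `θ`, virtual coordinates), START over the skew box
(`SatStart`, Siegel count over `𝔑` with the index identity `N = |det C|`), k-steps and signed Kummer half-steps along Nesterenko's schedule at
depth `ŜN = n + 24 + ⌊log₂(K·N)⌋ + lgg` (`PadicG3SatKStep`, `SatHalfSeparation`, `SatLevels`, `SatSchedule`), OUTPUT at `ξ = α^{1/N}` with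
`MomentGL` (`SatOutput`, `GenThreeEndBridgeReal`) ⇒ `G3Setup.frameOddRatPos_of_recordSatRD`; the record supply
`RecordSupplyOddSatRD ((2^{111})^·) p n` is `G3Setup.recordSupplyOddSatRD_of_headline` (`PadicG3SatNRecord`: p1's record `parOddN` on the
budget letter `W̃ = W + log N + log n! + 4 log n`, p1's budget `PadicG3ParNBudgetA–F` at every class depth `m`, the smallness exponent
`expLine_satN`, the END record `recordOddN_datumW`) at p1's HEADLINE `headline_N`; then the shells `padicCoreOddRatText_of_frame_two_le`
(ranks 0/1 elementary) at the zero estimate `Nesterenko2003_prop51_holds`.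

References: K. Yu, Forum Math. 19 (2007) Main Theorem (`K = ℚ`); K. Yu, Acta Math. 211 (2013) §§1, 3–7; Yu. V. Nesterenko, LNM 1819
(2003) §§3–5; E. M. Matveev, Izv. Math. 64 (2000) (the saturation device).
-/

open Finset

namespace Summit.ABC.ABC.Cruxes.PadicCoreOddRat.SatOddG3Frame

open Summit.ABC.StewartYu Summit.ABC.StewartYu.GenThreeFrameSpecOddRat Summit.ABC.StewartYu.GenThreeInductionOddRat
open Literature.NumberTheory.Transcendental Literature.NumberTheory.Transcendental.GaGm

/-- `0 ≤ C r ≤ c^r` for the line's constant function `C r = (2^{111})^r`. [folklore] -/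
theorem CLine_bounds : ∀ r, 0 ≤ ((2 : ℝ) ^ 111) ^ r ∧ ((2 : ℝ) ^ 111) ^ r ≤ ((2 : ℝ) ^ 111) ^ r :=
  fun r => ⟨by positivity, le_rfl⟩

/-- `2 ≤ C 1`. [folklore] -/
theorem two_le_CLine_one : (2 : ℝ) ≤ ((2 : ℝ) ^ 111) ^ 1 := by norm_num

/-- **STUB `stub_recordSat` DISCHARGED** (registered signature `Sig.stub_recordSat` of line `sat-odd`, with its constant function
`CLine m = (2^{111})^m` written out): the record supply of the saturated odd-`p` frame at every odd prime and rank `n ≥ 2`, from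
`G3Setup.recordSupplyOddSatRD_of_headline` at p1's headline `PadicG3ParN.headline_N` (`4·2^{100} ≤ 2^{111}`).
[cite: Nesterenko2003, Prop 4.1, §5; shape only] -/
theorem stub_recordSat : ∀ (p : ℕ) [Fact p.Prime], p ≠ 2 → ∀ n, 2 ≤ n →
    G3Setup.RecordSupplyOddSatRD (fun m => ((2 : ℝ) ^ 111) ^ m) p n := by
  intro p _ hp2 n hn
  exact G3Setup.recordSupplyOddSatRD_of_headline hn hp2 (by norm_num) (by positivity) (by norm_num)
    (fun P hθ hNq hA1 hAmax hK₀ => P.headline_N hθ hn hNq hA1 hAmax hK₀)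

/-- Composition: the crux BY NAME from the stub statement, through the ✓ lattice kit `satKitD_all`, the ✓ frame
`G3Setup.frameOddRatPos_of_recordSatRD`, the ✓ shell `padicCoreOddRatText_of_frame_two_le` and the ✓ zero estimate `Nesterenko2003_prop51_holds`.
[cite: Yu2007, Main Thm (K = ℚ); shape only] -/
theorem PadicCoreOddRat_of
    (hR : ∀ (p : ℕ) [Fact p.Prime], p ≠ 2 → ∀ n, 2 ≤ n → G3Setup.RecordSupplyOddSatRD (fun m => ((2 : ℝ) ^ 111) ^ m) p n) :
    Summit.ABC.ABC.Theses.YuMatveevShapeRat.PadicCoreOddRat := by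
  have hK : ∀ n, SatKitD n := satKitD_all
  have hF : Nesterenko2003_prop51 → ∀ p : ℕ, p.Prime → p ≠ 2 → ∀ n, 2 ≤ n →
      FrameOddRatPos (fun m => ((2 : ℝ) ^ 111) ^ m) p n := by
    intro _ p hp hp2 n hn
    haveI : Fact p.Prime := ⟨hp⟩
    exact G3Setup.frameOddRatPos_of_recordSatRD (by omega) hp2 (hK n) (hR p hp2 n hn)
  exact padicCoreOddRatText_of_frame_two_le CLine_bounds two_le_CLine_one hF Nesterenko2003_prop51_holds

/-- **CRUX `PadicCoreOddRat` OF ROUTE `YuMatveevShapeRat`** — the Kummer-free `p`-adic core over `ℚ` at odd `p` in shape form, uniform in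
`p`, in the kernel (line `sat-odd`, constant `c = 2^{111}`). [cite: Yu2007, Main Thm (K = ℚ); shape only] -/
theorem PadicCoreOddRat_proof : Summit.ABC.ABC.Theses.YuMatveevShapeRat.PadicCoreOddRat :=
  PadicCoreOddRat_of stub_recordSat

end Summit.ABC.ABC.Cruxes.PadicCoreOddRat.SatOddG3Frame
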